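import Summits.Ventures.PercRepro.RankLevelSetCycleArcs

/-! # RankLevelSetCycleStep — KATONA'S CYCLE METHOD, PART 2: THE TWO PER-CYCLE INEQUALITIES OF THE BOOLEAN (IO)
(night-1 g33; dossier §45)

For an INTERSECTING UP-SET `V` of subsets of `α` (`#α = n`) and a cyclic order `σ : ZMod n ≃ α`, let
`memberStarts V σ k = {s : arc σ s k ∈ V}` (the starts of the member `k`-arcs). THE STEP INEQUALITY
(**`two_mul_card_memberStarts_le`**, `2k ≤ n`): `2 · #memberStarts V σ k ≤ (n − k) · (#bdryL + #bdryR)`, where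
`bdryL V σ k = {s : arc σ s k ∉ V, arc σ s (k+1) ∈ V}` and `bdryR V σ k = {s : arc σ (s+1) k ∉ V, arc σ s (k+1) ∈ V}`
are the `(k+1)`-arcs in `V` whose left, resp. right, `k`-sub-arc is outside `V` — member `k`-arcs at cyclic distance
`k` are disjoint (so at most `n/2 ≤ n − k` of them), and if there is one, the cycle has a down-transition and an
up-transition, one in each boundary family. THE REFLECTION INEQUALITY (**`card_memberStarts_mul_le`**, `1 ≤ i`,
`2i ≤ n`): `(n + 1 − i) · #memberStarts V σ i ≤ i · #memberStarts V σ (n + 1 − i)` — Katona's bound `#memberStarts ≤ i`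
(**`card_memberStarts_le_of_intersecting`**: the starts of pairwise intersecting `i`-arcs inject into `range i`) and
the Minkowski growth `#((S + i) + [0, n − 2i + 1]) ≥ min n (#S + n − 2i + 1)` of the starts of the `(n+1−i)`-arcs
that contain a member `i`-arc. Averaged over all cyclic orders (next module) these two inequalities are exactly
`(n + 1 − k) v_k ≤ (k + 1) v_{k+1}` and `v_i ≤ v_{n+1−i}`, i.e. `NormSkew v (n + 1)`. Every declaration has a
docstring; imports: the cell's `RankLevelSetCycleArcs` and Mathlib only. Axioms: standard. -/

namespace PercRepro

namespace Cycle

open Finset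

variable {α : Type} [Fintype α] [DecidableEq α] {n : ℕ} [NeZero n]

/-! ## The member-arc starts and the two boundary families -/

/-- **The starts of the member `k`-arcs**: `{s : arc σ s k ∈ V}`. -/
def memberStarts (V : Finset (Finset α)) (σ : ZMod n ≃ α) (k : ℕ) : Finset (ZMod n) :=
  univ.filter (fun s => arc σ s k ∈ V)

/-- **The left boundary starts**: the `(k+1)`-arcs in `V` whose left `k`-sub-arc (same start) is outside `V`. -/
def bdryL (V : Finset (Finset α)) (σ : ZMod n ≃ α) (k : ℕ) : Finset (ZMod n) :=
  univ.filter (fun s => arc σ s k ∉ V ∧ arc σ s (k + 1) ∈ V)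

/-- **The right boundary starts**: the `(k+1)`-arcs in `V` whose right `k`-sub-arc (start `s + 1`) is outside `V`. -/
def bdryR (V : Finset (Finset α)) (σ : ZMod n ≃ α) (k : ℕ) : Finset (ZMod n) :=
  univ.filter (fun s => arc σ (s + 1) k ∉ V ∧ arc σ s (k + 1) ∈ V)

/-- Membership in `memberStarts`. -/
lemma mem_memberStarts {V : Finset (Finset α)} {σ : ZMod n ≃ α} {k : ℕ} {s : ZMod n} :
    s ∈ memberStarts V σ k ↔ arc σ s k ∈ V := by simp [memberStarts]

/-- Membership in `bdryL`. -/
lemma mem_bdryL {V : Finset (Finset α)} {σ : ZMod n ≃ α} {k : ℕ} {s : ZMod n} :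
    s ∈ bdryL V σ k ↔ arc σ s k ∉ V ∧ arc σ s (k + 1) ∈ V := by simp [bdryL]

/-- Membership in `bdryR`. -/
lemma mem_bdryR {V : Finset (Finset α)} {σ : ZMod n ≃ α} {k : ℕ} {s : ZMod n} :
    s ∈ bdryR V σ k ↔ arc σ (s + 1) k ∉ V ∧ arc σ s (k + 1) ∈ V := by simp [bdryR]

/-- In an intersecting family, a member `k`-arc start `s` forces `s + k` not to be one (`2k ≤ n`). -/
lemma add_notMem_memberStarts {V : Finset (Finset α)} (hV : (V : Set (Finset α)).Intersecting)
    {σ : ZMod n ≃ α} {k : ℕ} (hk : 2 * k ≤ n) {s : ZMod n} (hs : s ∈ memberStarts V σ k) :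
    s + (k : ZMod n) ∉ memberStarts V σ k := by
  rw [mem_memberStarts] at hs ⊢
  intro h
  exact hV (Finset.mem_coe.mpr hs) (Finset.mem_coe.mpr h) (disjoint_arc_add σ s hk)

/-- At most half of the starts are member `k`-arc starts (`2k ≤ n`). -/
lemma two_mul_card_memberStarts_le_n {V : Finset (Finset α)} (hV : (V : Set (Finset α)).Intersecting)
    {σ : ZMod n ≃ α} {k : ℕ} (hk : 2 * k ≤ n) : 2 * (memberStarts V σ k).card ≤ n := by
  have hinj : (memberStarts V σ k).card ≤ (univ \ memberStarts V σ k).card := by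
    apply Finset.card_le_card_of_injOn (fun s => s + (k : ZMod n))
    · intro s hs
      exact Finset.mem_sdiff.mpr ⟨Finset.mem_univ _, add_notMem_memberStarts hV hk hs⟩
    · intro s _ s' _ h
      exact add_right_cancel h
  have := Finset.card_sdiff_of_subset (Finset.subset_univ (memberStarts V σ k))
  rw [Finset.card_univ, ZMod.card] at this
  omega

/-! ## The step inequality -/

/-- **THE PER-CYCLE STEP INEQUALITY**: for an intersecting up-set `V` and `2k ≤ n`,
`2 · #memberStarts V σ k ≤ (n − k) · (#bdryL V σ k + #bdryR V σ k)`. -/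
theorem two_mul_card_memberStarts_le {V : Finset (Finset α)} (hV : (V : Set (Finset α)).Intersecting)
    (hup : IsUpperSet (V : Set (Finset α))) (σ : ZMod n ≃ α) {k : ℕ} (hk : 2 * k ≤ n) :
    2 * (memberStarts V σ k).card ≤ (n - k) * ((bdryL V σ k).card + (bdryR V σ k).card) := by
  rcases (memberStarts V σ k).eq_empty_or_nonempty with hS | ⟨s, hs⟩
  · rw [hS]; simp
  have hu := add_notMem_memberStarts hV hk hs
  rw [mem_memberStarts] at hs hu
  -- a down-transition gives a left boundary start
  obtain ⟨t₁, ht₁, ht₁'⟩ := exists_transition (fun t => arc σ t k ∈ V) hs hu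
  have hL : t₁ ∈ bdryL V σ k := by
    rw [mem_bdryL]
    exact ⟨ht₁, hup (Finset.coe_subset.mpr (arc_add_one_subset_arc_succ σ t₁ k)) ht₁'⟩
  -- an up-transition gives a right boundary start
  obtain ⟨t₂, ht₂, ht₂'⟩ := exists_transition (fun t => arc σ t k ∉ V) hu (not_not.mpr hs)
  have hR : t₂ ∈ bdryR V σ k := by
    rw [mem_bdryR]
    refine ⟨ht₂', hup (Finset.coe_subset.mpr (arc_subset_arc_succ σ t₂ k)) ?_⟩
    exact not_not.mp ht₂
  have h1 : 1 ≤ (bdryL V σ k).card := Finset.card_pos.mpr ⟨t₁, hL⟩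
  have h2 : 1 ≤ (bdryR V σ k).card := Finset.card_pos.mpr ⟨t₂, hR⟩
  have hhalf := two_mul_card_memberStarts_le_n hV (σ := σ) hk
  have hle : (memberStarts V σ k).card ≤ n - k := by omega
  calc 2 * (memberStarts V σ k).card ≤ 2 * (n - k) := by omega
    _ = (n - k) * 2 := by ring
    _ ≤ (n - k) * ((bdryL V σ k).card + (bdryR V σ k).card) := Nat.mul_le_mul_left _ (by omega)

/-! ## Katona's bound -/

/-- For two member `K`-arc starts `s₀, s` of an intersecting family (`2K ≤ n`), the value `w = (s − s₀ + K).val`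
lies in `[1, 2K − 1]`: the two arcs share an element `x`, and `s − s₀ + K = (x − s₀) + (K − (x − s))`. -/
lemma val_sub_add_bounds {V : Finset (Finset α)} (hV : (V : Set (Finset α)).Intersecting)
    {σ : ZMod n ≃ α} {K : ℕ} (hK : 2 * K ≤ n) {s₀ s : ZMod n}
    (hs₀ : s₀ ∈ memberStarts V σ K) (hs : s ∈ memberStarts V σ K) :
    1 ≤ (s - s₀ + (K : ZMod n)).val ∧ (s - s₀ + (K : ZMod n)).val + 1 ≤ 2 * K := by
  rw [mem_memberStarts] at hs₀ hs
  have hnd := hV (Finset.mem_coe.mpr hs) (Finset.mem_coe.mpr hs₀)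
  rw [Finset.not_disjoint_iff] at hnd
  obtain ⟨x, hx, hx₀⟩ := hnd
  rw [mem_arc] at hx hx₀
  have h1 : (σ.symm x - s₀) = (((σ.symm x - s₀).val : ℕ) : ZMod n) := (ZMod.natCast_zmod_val _).symm
  have h2 : (σ.symm x - s) = (((σ.symm x - s).val : ℕ) : ZMod n) := (ZMod.natCast_zmod_val _).symm
  have hsplit : s - s₀ + (K : ZMod n) = (σ.symm x - s₀) - (σ.symm x - s) + (K : ZMod n) := by ring
  generalize ha : (σ.symm x - s₀).val = a at hx₀ h1
  generalize hc : (σ.symm x - s).val = c at hx h2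
  have heq : s - s₀ + (K : ZMod n) = ((a + (K - c) : ℕ) : ZMod n) := by
    rw [hsplit, h1, h2, Nat.cast_add, Nat.cast_sub hx.le]
    ring
  rw [heq, ZMod.val_cast_of_lt (by omega)]
  omega

/-- Two member `K`-arc starts whose values differ by exactly `K` are at cyclic distance `K`. -/
lemma eq_add_of_val_eq {K : ℕ} {s₀ s s' : ZMod n}
    (h : (s' - s₀ + (K : ZMod n)).val = (s - s₀ + (K : ZMod n)).val + K) : s' = s + (K : ZMod n) := by
  have h1 : s' - s₀ + (K : ZMod n) = (((s' - s₀ + (K : ZMod n)).val : ℕ) : ZMod n) :=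
    (ZMod.natCast_zmod_val _).symm
  have h2 : s - s₀ + (K : ZMod n) = (((s - s₀ + (K : ZMod n)).val : ℕ) : ZMod n) :=
    (ZMod.natCast_zmod_val _).symm
  have : s' - s₀ + (K : ZMod n) = (s - s₀ + (K : ZMod n)) + (K : ZMod n) := by
    rw [h1, h, Nat.cast_add, ← h2]
  have h3 : s' - s₀ = s - s₀ + (K : ZMod n) := by
    have := this; rw [add_assoc, add_comm (K : ZMod n) (K : ZMod n)] at this
    exact add_right_cancel (a := s' - s₀) (by rw [this]; ring)
  rw [sub_eq_iff_eq_add] at h3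
  rw [h3]; ring

/-- **KATONA'S BOUND**: the starts of the member `K`-arcs of an intersecting family number at most `K` when
`2K ≤ n` (the map `s ↦ w(s)` if `w(s) < K` else `w(s) − K`, with `w(s) = (s − s₀ + K).val ∈ [1, 2K−1]`, is
injective into `range K`: equal values at distance `K` would give two disjoint member arcs). -/
theorem card_memberStarts_le_of_intersecting {V : Finset (Finset α)} (hV : (V : Set (Finset α)).Intersecting)
    (σ : ZMod n ≃ α) {K : ℕ} (hK : 2 * K ≤ n) : (memberStarts V σ K).card ≤ K := by
  rcases (memberStarts V σ K).eq_empty_or_nonempty with hS | ⟨s₀, hs₀⟩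
  · rw [hS]; simp
  have hK1 : 1 ≤ K := by
    by_contra h
    have hK0 : K = 0 := by omega
    have hs₀' := mem_memberStarts.mp hs₀
    rw [hK0, arc_zero] at hs₀'
    exact hV (Finset.mem_coe.mpr hs₀') (Finset.mem_coe.mpr hs₀') (Finset.disjoint_empty_left _)
  let w : ZMod n → ℕ := fun s => (s - s₀ + (K : ZMod n)).val
  let f : ZMod n → ℕ := fun s => if w s < K then w s else w s - K
  have hbounds : ∀ s ∈ memberStarts V σ K, 1 ≤ w s ∧ w s + 1 ≤ 2 * K :=
    fun s hs => val_sub_add_bounds hV hK hs₀ hs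
  have hmaps : Set.MapsTo f (memberStarts V σ K) (Finset.range K) := by
    intro s hs
    have := hbounds s hs
    simp only [Finset.coe_range, Set.mem_Iio, f]
    split_ifs <;> omega
  have hinj : Set.InjOn f (memberStarts V σ K) := by
    intro s hs s' hs' hf
    have hb := hbounds s hs
    have hb' := hbounds s' hs'
    have hdist : ¬ s' = s + (K : ZMod n) := fun h => add_notMem_memberStarts hV hK hs (h ▸ hs')
    have hdist' : ¬ s = s' + (K : ZMod n) := fun h => add_notMem_memberStarts hV hK hs' (h ▸ hs)
    have hval : w s = w s' := by
      simp only [f] at hf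
      split_ifs at hf with h1 h2 h2
      · exact hf
      · exact absurd (eq_add_of_val_eq (K := K) (s₀ := s₀) (by show w s' = w s + K; omega)) hdist
      · exact absurd (eq_add_of_val_eq (K := K) (s₀ := s₀) (by show w s = w s' + K; omega)) hdist'
      · omega
    have := ZMod.val_injective n hval
    simpa using this
  calc (memberStarts V σ K).card ≤ (Finset.range K).card := Finset.card_le_card_of_injOn f hmaps hinj
    _ = K := Finset.card_range K

/-! ## The reflection inequality -/

omit [DecidableEq α] in
/-- The `(n − i)`-arc starting at `s + (2i + 1 + l)` contains the `(i+1)`-arc starting at `s` (`2i + 1 + l ≤ n`):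
its complement is the `i`-arc `[s + i + 1 + l, s + 2i + l]`, which lies beyond the `(i+1)`-arc at `s`. -/
lemma arc_subset_arc_of_le (σ : ZMod n ≃ α) (s : ZMod n) {i l : ℕ} (hl : 2 * i + 1 + l ≤ n) :
    arc σ s (i + 1) ⊆ arc σ (s + ((2 * i + 1 + l : ℕ) : ZMod n)) (n - i) := by
  intro x hx
  rw [mem_arc] at hx ⊢
  have hrw : σ.symm x - (s + ((2 * i + 1 + l : ℕ) : ZMod n)) =
      (σ.symm x - s) - ((2 * i + 1 + l : ℕ) : ZMod n) := by ring
  rw [hrw, val_sub_natCast_of_lt (by omega) hl]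
  omega

/-- **THE PER-CYCLE REFLECTION INEQUALITY**: for an intersecting up-set `V` and `2(i + 1) ≤ n`,
`(n − i) · #memberStarts V σ (i + 1) ≤ (i + 1) · #memberStarts V σ (n − i)`: the `(n−i)`-arcs containing a member
`(i+1)`-arc start at `S + (i + 1) + [0, n − 2i − 1] + i`, a set of at least `min n (#S + n − 2i − 1)` starts
(Minkowski growth), while `#S ≤ i + 1` (Katona). -/
theorem card_memberStarts_mul_le {V : Finset (Finset α)} (hV : (V : Set (Finset α)).Intersecting)
    (hup : IsUpperSet (V : Set (Finset α))) (σ : ZMod n ≃ α) {i : ℕ} (hi : 2 * (i + 1) ≤ n) :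
    (n - i) * (memberStarts V σ (i + 1)).card ≤ (i + 1) * (memberStarts V σ (n - i)).card := by
  rcases (memberStarts V σ (i + 1)).eq_empty_or_nonempty with hS | hSne
  · rw [hS]; simp
  have hkat : (memberStarts V σ (i + 1)).card ≤ i + 1 := card_memberStarts_le_of_intersecting hV σ hi
  set A : Finset (ZMod n) := (memberStarts V σ (i + 1)).image (· + ((i + 1 : ℕ) : ZMod n)) with hA
  have hAcard : A.card = (memberStarts V σ (i + 1)).card :=
    Finset.card_image_of_injective _ (add_left_injective _)
  have hAne : A.Nonempty := hSne.image _
  have hT := card_grow_iterate hAne (n - 2 * i - 1)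
  have hTsub : (grow^[n - 2 * i - 1] A).image (· + (i : ZMod n)) ⊆ memberStarts V σ (n - i) := by
    intro w hw
    obtain ⟨u, hu, rfl⟩ := Finset.mem_image.mp hw
    obtain ⟨a, ha, l, hl, rfl⟩ := mem_grow_iterate hu
    obtain ⟨s, hs, rfl⟩ := Finset.mem_image.mp ha
    rw [mem_memberStarts]
    have hsub := arc_subset_arc_of_le σ s (i := i) (l := l) (by omega)
    have heq : s + ((i + 1 : ℕ) : ZMod n) + (l : ZMod n) + (i : ZMod n) =
        s + ((2 * i + 1 + l : ℕ) : ZMod n) := by push_cast; ring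
    rw [heq]
    exact hup (Finset.coe_subset.mpr hsub) (mem_memberStarts.mp hs)
  have hTcard : ((grow^[n - 2 * i - 1] A).image (· + (i : ZMod n))).card = (grow^[n - 2 * i - 1] A).card :=
    Finset.card_image_of_injective _ (add_left_injective _)
  have hM : (grow^[n - 2 * i - 1] A).card ≤ (memberStarts V σ (n - i)).card :=
    hTcard ▸ Finset.card_le_card hTsub
  rw [hAcard] at hT
  rcases le_or_gt n ((memberStarts V σ (i + 1)).card + (n - 2 * i - 1)) with h | h
  · have hn : n ≤ (memberStarts V σ (n - i)).card := by
      rw [min_eq_left h] at hT; exact hT.trans hM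
    calc (n - i) * (memberStarts V σ (i + 1)).card ≤ (n - i) * (i + 1) := Nat.mul_le_mul_left _ hkat
      _ ≤ n * (i + 1) := Nat.mul_le_mul_right _ (Nat.sub_le n i)
      _ = (i + 1) * n := by ring
      _ ≤ (i + 1) * (memberStarts V σ (n - i)).card := Nat.mul_le_mul_left _ hn
  · have hn : (memberStarts V σ (i + 1)).card + (n - 2 * i - 1) ≤ (memberStarts V σ (n - i)).card := by
      rw [min_eq_right h.le] at hT; exact hT.trans hM
    have hsplit : n - i = (i + 1) + (n - 2 * i - 1) := by omega
    calc (n - i) * (memberStarts V σ (i + 1)).card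
        = (i + 1) * (memberStarts V σ (i + 1)).card + (n - 2 * i - 1) * (memberStarts V σ (i + 1)).card := by
          rw [hsplit, add_mul]
      _ ≤ (i + 1) * (memberStarts V σ (i + 1)).card + (n - 2 * i - 1) * (i + 1) :=
          Nat.add_le_add_left (Nat.mul_le_mul_left _ hkat) _
      _ = (i + 1) * ((memberStarts V σ (i + 1)).card + (n - 2 * i - 1)) := by ring
      _ ≤ (i + 1) * (memberStarts V σ (n - i)).card := Nat.mul_le_mul_left _ hn

end Cycle

end PercRepro
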